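import Summits.HodgeConjecture.HodgeConjecture.Theses.DeltaPeriodAudit

/-!
# Birth skeleton (BC3) for crux `RationalNewformPeriodRatio` — route `DeltaPeriodAudit`

Crux (item `stmt-HodgeConjecture-2366`, rank 5, "THE BET", expected false):
`Summit.HodgeConjecture.HodgeConjecture.Theses.DeltaPeriodAudit.RationalNewformPeriodRatio` —
there is a newform `f ∈ S_k(Γ₀(N))`, `k ≥ 3`, with rational Fourier coefficients and no CM, and
critical indices `a, b` (`a + 2, b + 2 ≤ k`) of opposite parity with
`s_a(f) s_b(f) ≠ 0` and `(s_a(f)/s_b(f))² ∈ ℚ`, where `s_j(f) = ∫₀^∞ tʲ Re f(it) dt`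
(`= Λ(f, j+1)`, the completed critical value; `f(it)` is real for a newform on `Γ₀(N)`).

## The line: Haberland splitting of the cross-parity ratio

Write `P = (f,f)` for the tree's Petersson norm `peterssonProduct (Γ₀ N) k f f` (real, `> 0`).

* `stub_crossParityProductRational` (THEOREM-GRADE, M): for a newform on `Γ₀(N)` with `K_f = ℚ`
  and critical `a, b` of opposite parity, `s_a(f) · s_b(f) ∈ ℚ · P`. This is Paşol–Popa 2013,
  Prop. 5.11(b) (corrected normalisation `2^{k-1}`) with Cor. 5.12 at `K_f = ℚ`: the even-index
  values are `ℚ`-multiples of one real period `Ω⁻`, the odd-index ones of `Ω⁺`, and Haberland's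
  formula gives `Ω⁺Ω⁻/(f,f) ∈ K_f`. In the tree: `PasolPopa2013_criticalValuesRationalityCorrected_holds`,
  `IsNewform0.exists_periods_criticalValues'`, `IsNewform0.periods_div_petersson_mem_coeffField`,
  `IsNewform0.cuspCoeff_im_eq_zero` + `im_apply_ofComplex_mul_I_eq_zero` (reality of `f(it)`),
  `completedLValue` ↔ the real integral `s_j`. What remains is the unpacking at `K_f = ⊥`, the
  powers of `i`, and the identification of `completedLValue f (j+1)` with `s_j` — a genuine
  M-sized lemma, not a one-liner.
* `stub_quarticPeterssonWitness` (THE TRANSFERRED BET, open): a rational non-CM newform of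
  weight `≥ 3` on some `Γ₀(N)` with critical `a, b` of opposite parity, `s_a s_b ≠ 0`, and
  `s_b(f)⁴ ∈ ℚ · P²` — ONE critical value whose fourth power is commensurable with the square of
  the Petersson norm. Transfer `C⁺`: given stub 1, `(s_a/s_b)² = (s_a s_b)²/s_b⁴ ∈ ℚ ⟺ s_b⁴/P² ∈ ℚ`,
  so the cross-parity coincidence is re-expressed through a SINGLE parity and `(f,f)`; since
  `(f,f) ≐ L(Sym² f, k)` up to `π`-powers and rationals (Rankin–Selberg / Sturm), the census for
  `C⁺` needs one parity of critical values plus `L(Sym² f, k)` (PARI `mfpetersson` / `lfunsympow`,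
  an algorithm independent of the period-polynomial one — it cross-checks the normalisation risk
  named in the route header), and the statement is a relation among critical values of TWO
  motives (`M_f`, `Sym² M_f`) to which Deligne-period bookkeeping applies term by term.
* `RationalNewformPeriodRatio_of` (assembly, proved; hypotheses = the name-keyed aliases
  `Registered.stub_*` of the two stub statements, as the skeleton audit requires; wiring `example` below): `q' = r²/q` where `s_a s_b = r P` and
  `s_b⁴ = q P²` (`P ≠ 0` because `s_a s_b ≠ 0`; `q ≠ 0` because `s_b ≠ 0`).

Disproof used: none on file for this crux (`ledger crux ls stmt-HodgeConjecture-2366`: no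
workfiles, 2026-08-17). Negatives index / dead lines: none recorded for this crux.
-/

namespace Summit.HodgeConjecture.HodgeConjecture.Cruxes.RationalNewformPeriodRatio.Birth

open Literature.NumberTheory.EllipticCurves.ModularForms
open Summit.HodgeConjecture.HodgeConjecture.Theses.DeltaPeriodAudit (RationalNewformPeriodRatio)

/-! ## §1 The stubs (the ONLY `sorry`s of this file) -/

/-- **Stub 1 (Haberland/Paşol–Popa product rationality at `K_f = ℚ`).** For a newform
`f ∈ S_k(Γ₀(N))` with rational coefficients and critical indices `a, b` of opposite parity, the
product of the two real axis periods `s_a(f) s_b(f)` is a rational multiple of the Petersson norm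
`(f,f)`. [PasolPopa2013, Prop. 5.11(b) (corrected) + Cor. 5.12; Manin1973 Thm. 1.3 at level one;
tree: `PasolPopa2013_criticalValuesRationalityCorrected_holds`.] -/
theorem stub_crossParityProductRational :
    ∀ (N : ℕ) [NeZero N] (k : ℤ) (f : CuspForm (CongruenceSubgroup.Gamma0 N) k),
      IsNewform0 f → coeffField f = ⊥ →
      ∀ a b : ℕ, (a : ℤ) + 2 ≤ k → (b : ℤ) + 2 ≤ k → Odd (a + b) →
        ∃ r : ℚ,
          (∫ t in Set.Ioi (0:ℝ), t ^ a * (f (UpperHalfPlane.ofComplex ((t : ℂ) * Complex.I))).re) *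
            (∫ t in Set.Ioi (0:ℝ), t ^ b * (f (UpperHalfPlane.ofComplex ((t : ℂ) * Complex.I))).re) =
          (r : ℝ) * (peterssonProduct (CongruenceSubgroup.Gamma0 N) k f f).re := by
  sorry

/-- **Stub 2 (the transferred bet `C⁺`: a quartic single-parity coincidence).** There is a
newform `f ∈ S_k(Γ₀(N))`, `k ≥ 3`, with rational coefficients and no CM (Ribet's cofinite
twist-invariance form, verbatim from the crux), and critical indices `a, b` of opposite parity
with `s_a(f) ≠ 0`, `s_b(f) ≠ 0` and `s_b(f)⁴ = q · (f,f)²` for a rational `q`. Expected FALSE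
(it is equivalent to the crux given stub 1, hence contradicts HC via the rank-4 crux); a census
decides it one form at a time from ONE parity of critical values and `L(Sym² f, k)`.
[PasolPopa2013 §5.3; Shimura1977; KontsevichZagierPeriods2001 (independence folklore).] -/
theorem stub_quarticPeterssonWitness :
    ∃ (N : ℕ) (_ : NeZero N) (k : ℤ) (f : CuspForm (CongruenceSubgroup.Gamma0 N) k) (a b : ℕ) (q : ℚ),
      3 ≤ k ∧ IsNewform0 f ∧ coeffField f = ⊥ ∧
      (¬ ∃ (M : ℕ) (η : DirichletCharacter ℂ M), η ≠ 1 ∧ ∀ᶠ p : ℕ in Filter.cofinite, p.Prime →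
        η (p : ZMod M) * heckeEigenvalue f p = heckeEigenvalue f p) ∧
      (a : ℤ) + 2 ≤ k ∧ (b : ℤ) + 2 ≤ k ∧ Odd (a + b) ∧
      (∫ t in Set.Ioi (0:ℝ), t ^ a * (f (UpperHalfPlane.ofComplex ((t : ℂ) * Complex.I))).re) ≠ 0 ∧
      (∫ t in Set.Ioi (0:ℝ), t ^ b * (f (UpperHalfPlane.ofComplex ((t : ℂ) * Complex.I))).re) ≠ 0 ∧
      (∫ t in Set.Ioi (0:ℝ), t ^ b * (f (UpperHalfPlane.ofComplex ((t : ℂ) * Complex.I))).re) ^ 4 =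
        (q : ℝ) * ((peterssonProduct (CongruenceSubgroup.Gamma0 N) k f f).re) ^ 2 := by
  sorry

/-! ### Name-keyed aliases of the two stub statements (the skeleton audit admits a hypothesis of
`RationalNewformPeriodRatio_of` iff the head constant of its type has the short name of a declared
stub; the texts below are verbatim the stub signatures, and the wiring `example` of §2 checks it) -/
namespace Registered

/-- Alias of the statement of `stub_crossParityProductRational`, keyed by the stub name. -/
abbrev stub_crossParityProductRational : Prop :=
    ∀ (N : ℕ) [NeZero N] (k : ℤ) (f : CuspForm (CongruenceSubgroup.Gamma0 N) k),
      IsNewform0 f → coeffField f = ⊥ →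
      ∀ a b : ℕ, (a : ℤ) + 2 ≤ k → (b : ℤ) + 2 ≤ k → Odd (a + b) →
        ∃ r : ℚ,
          (∫ t in Set.Ioi (0:ℝ), t ^ a * (f (UpperHalfPlane.ofComplex ((t : ℂ) * Complex.I))).re) *
            (∫ t in Set.Ioi (0:ℝ), t ^ b * (f (UpperHalfPlane.ofComplex ((t : ℂ) * Complex.I))).re) =
          (r : ℝ) * (peterssonProduct (CongruenceSubgroup.Gamma0 N) k f f).re

/-- Alias of the statement of `stub_quarticPeterssonWitness`, keyed by the stub name. -/
abbrev stub_quarticPeterssonWitness : Prop :=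
    ∃ (N : ℕ) (_ : NeZero N) (k : ℤ) (f : CuspForm (CongruenceSubgroup.Gamma0 N) k) (a b : ℕ) (q : ℚ),
      3 ≤ k ∧ IsNewform0 f ∧ coeffField f = ⊥ ∧
      (¬ ∃ (M : ℕ) (η : DirichletCharacter ℂ M), η ≠ 1 ∧ ∀ᶠ p : ℕ in Filter.cofinite, p.Prime →
        η (p : ZMod M) * heckeEigenvalue f p = heckeEigenvalue f p) ∧
      (a : ℤ) + 2 ≤ k ∧ (b : ℤ) + 2 ≤ k ∧ Odd (a + b) ∧
      (∫ t in Set.Ioi (0:ℝ), t ^ a * (f (UpperHalfPlane.ofComplex ((t : ℂ) * Complex.I))).re) ≠ 0 ∧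
      (∫ t in Set.Ioi (0:ℝ), t ^ b * (f (UpperHalfPlane.ofComplex ((t : ℂ) * Complex.I))).re) ≠ 0 ∧
      (∫ t in Set.Ioi (0:ℝ), t ^ b * (f (UpperHalfPlane.ofComplex ((t : ℂ) * Complex.I))).re) ^ 4 =
        (q : ℝ) * ((peterssonProduct (CongruenceSubgroup.Gamma0 N) k f f).re) ^ 2

end Registered

/-! ## §2 Composition (no `sorry` below this line) -/

/-- **Assembly (kernel-checked): the two stubs imply the crux, BY NAME.** Haberland product
rationality (stub 1) and a quartic single-parity witness (stub 2) give the crux: with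
`s_a s_b = r·(f,f)` and `s_b⁴ = q·(f,f)²`, `(s_a/s_b)² = (s_a s_b)²/s_b⁴ = r²/q ∈ ℚ`
(`(f,f) ≠ 0` because `s_a s_b ≠ 0`; `q ≠ 0` because `s_b ≠ 0`). -/
theorem RationalNewformPeriodRatio_of (hprod : Registered.stub_crossParityProductRational)
    (hwit : Registered.stub_quarticPeterssonWitness) : RationalNewformPeriodRatio := by
  unfold Registered.stub_crossParityProductRational at hprod
  unfold Registered.stub_quarticPeterssonWitness at hwit
  obtain ⟨N, hN, k, f, a, b, q, hk, hnew, hK, hCM, ha, hb, hab, hsa, hsb, hq⟩ := hwit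
  obtain ⟨r, hr⟩ := @hprod N hN k f hnew hK a b ha hb hab
  refine ⟨N, hN, k, f, a, b, r ^ 2 / q, hk, hnew, hK, hCM, ha, hb, hab, hsa, hsb, ?_⟩
  -- abbreviate the three real numbers
  set A : ℝ := ∫ t in Set.Ioi (0:ℝ), t ^ a * (f (UpperHalfPlane.ofComplex ((t : ℂ) * Complex.I))).re
    with hA
  set B : ℝ := ∫ t in Set.Ioi (0:ℝ), t ^ b * (f (UpperHalfPlane.ofComplex ((t : ℂ) * Complex.I))).re
    with hB
  set P : ℝ := (peterssonProduct (CongruenceSubgroup.Gamma0 N) k f f).re with hP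
  -- the Petersson norm cannot vanish, else `s_a s_b = 0`
  have hP0 : P ≠ 0 := by
    intro h0
    apply mul_ne_zero hsa hsb
    rw [hr, h0, mul_zero]
  -- `q ≠ 0`, else `s_b⁴ = 0`
  have hq0 : (q : ℝ) ≠ 0 := by
    intro h0
    apply pow_ne_zero 4 hsb
    rw [hq, h0, zero_mul]
  have hB2 : B ^ 2 ≠ 0 := pow_ne_zero 2 hsb
  push_cast
  rw [div_pow, div_eq_div_iff hB2 hq0]
  -- goal: A ^ 2 * q = r ^ 2 * B ^ 2; multiply through by B² ≠ 0
  apply mul_right_cancel₀ hB2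
  have h4 : B ^ 2 * B ^ 2 = (q : ℝ) * P ^ 2 := by rw [← hq]; ring
  calc A ^ 2 * (q : ℝ) * B ^ 2 = (A * B) ^ 2 * q := by ring
    _ = ((r : ℝ) * P) ^ 2 * q := by rw [hr]
    _ = (r : ℝ) ^ 2 * ((q : ℝ) * P ^ 2) := by ring
    _ = (r : ℝ) ^ 2 * (B ^ 2 * B ^ 2) := by rw [h4]
    _ = (r : ℝ) ^ 2 * B ^ 2 * B ^ 2 := by ring


/-- Wiring check: the registered stubs feed the composition exactly as stated (definitional
unfolding of the `Registered.*` aliases only). -/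
example : RationalNewformPeriodRatio :=
  RationalNewformPeriodRatio_of stub_crossParityProductRational stub_quarticPeterssonWitness

end Summit.HodgeConjecture.HodgeConjecture.Cruxes.RationalNewformPeriodRatio.Birth
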